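import Summits.NavierStokesRegularity.NavierStokesRegularity.Theorems.HeredityAtOne.Negative.CapStratumEnergyBound

/-!
# The impulse-free COMBINED door of the silent signed swirl-free sub-register (disprover g6 on item 19249)

Cell `ns-blowup`, seat `refuter-ns-palasek-19249-disprove-1` (g6; DISPROVER on route `PalasekTowerBreakdown`, item
stmt-NavierStokesRegularity-19249 `HeredityAtOne = HeredityAt 1`). Sequel of `CapStratumEnergyBound.lean` (p516683),
which states the two doors of the silent signed swirl-free sub-register SEPARATELY — the Gallay–Šverák cap door of the
capped stratum `𝒮_k` (`0.35356 · √(√((∫η)(∫r²η)) · M') < c₁ Y_{k+1}` on the `τ_k`-slice, `InCapStratum k`) and the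
energy door `4 E(s.u τ_k) ≤ c₁ Y₀ · ∫ r²η(s.u τ_k)` — both carrying the impulse `I = ∫ r²η`. The impulse is the one
slice functional a design controls for free (a far, slow co-signed halo ring adds impulse and almost nothing else), so
the informative necessary condition is the PRODUCT of the two doors, in which `I` cancels:

* `combined_door_of_silent_signed_slice` (any rates `R`, margins `Margins.routeG R`, any level `k`): on a SILENT design
  (`S.f = 0` on `[τ₀, ∞)`) whose host slice `s.u τ₀` is single-signed swirl-free, a registered level-`k` stage whose
  `τ_k`-slice is single-signed swirl-free of height `M'` with cap value `< c₁ Y_{k+1}` satisfies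
  **`4 · 0.35356⁴ · E(s.u τ_k) · (∫η(s.u τ_k)) · M'² < c₁⁵ · Y₀ · Y_{k+1}⁴`**.
* `combined_door_floor_form` (same setting): at every floor point `x` of the readout (`c₁ Y_k ≤ ‖s.u τ_k x‖`, one exists
  by `Stage.floor`), `4 · 0.35356⁴ · Y_k⁵ · (E · ∫η · M'²) < Y₀ · Y_{k+1}⁴ · ‖s.u τ_k x‖⁵`, i.e. the scale-free slice
  number `F := E · (∫η) · M'² / (sup‖u‖)⁵` obeys `F < Y₀ Y_{k+1}⁴ / (4 · 0.35356⁴ · Y_k⁵)`.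
* `combined_door_of_inCapStratum_silent`, `combined_door_of_silent_capped_host` (wide rates, `c₁ = 1` by rigidity):
  the same for members of `InCapStratum k` (p481383) on silent signed designs, resp. under the host-form cap hypothesis
  of `inCapStratum_of_silent` (p505438).

NUMBERS (wide rates `N₀ = 256`, `b = 11/10`, `β = 23/10`; `Y_k = N_k^{13/10}`; decimal values are docstring
arithmetic, not kernel facts): the bound `Y₀Y_{k+1}⁴/(4·0.35356⁴·Y_k⁵)` is `185.6 (k=1)`, `115.3 (k=2)`, `68.3 (k=3)`,
`38.4 (k=4)`, `20.4 (k=5)`, `10.2 (k=6)`; it equals `s_k/t_k⁴` with the speed-efficiency door `e := sup‖u‖/(((∫η)(∫r²η))^{1/4}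
M'^{1/2}) > t_k := 0.35356·Y_k/Y_{k+1}` (`0.160, 0.148, 0.135, 0.123, 0.111, 0.099`) and the energy-efficiency door
`ε := E/(sup‖u‖·∫r²η) < s_k := Y₀/(4Y_k)` (`0.1216, 0.0550, 0.0230, 0.0088, 0.0031, 0.00096`) of p516683, and
`F = ε/e⁴` is INVARIANT under impulse dilution by a far halo (`e ↦ e·x^{1/4}`, `ε ↦ ε·x`, `x = I/(I + ΔI)`), which the
separate doors are not. Census of record (g5, kit job j272424, 50 signed swirl-free profiles; g6 job j274433, 17 more):
Hill's spherical vortex `F = 7776π²/945 = 81.2` (`e = 0.2048`, `ε = 1/7`); minimum over the census `F = 75.8` (oblate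
spheroidal `η`-patch, axis ratio `0.75`, `e = 0.208`); uniform-`η` tori `F = 76 … 373` (fat … `s/R = 0.1`), thin
uniform-core rings `F = 32π⁴(δ/R)(log(8R/δ) − 7/4) → 0` but `e → (2π√2)⁻¹ = 0.1125`; peaked / hollow / two-component
profiles `F ≥ 92`. Hence, for the census families: levels `k = 1, 2` pass both static doors (Hill-type cores, with or
without a halo; peaked balls `p ∈ [1, 2.5]` pass even undiluted), levels `k = 3, 4` are EMPTY (every census profile with
`e > t_k` has `F ≥ 75.8 > 68.3`), levels `k ≥ 5` pass again (thin rings, `R/δ ≳ 2·10³`). Whether `inf F` over ALL signed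
swirl-free profiles with `e > 0.135` lies below `68.3` is open (g6 kit job on `η`-patch shape optimisation, see the
seat's Disproof.lean (L9)).

What this does NOT do: it constructs nothing and refutes nothing; the level-1 doors are statically inhabited, so the
emptiness of `InCapStratum 1` (the conjunct `CapStatumEmptyAt 1` of item 19249, p481383) remains a DYNAMICAL question
(an unforced signed swirl-free flow would have to double its speed efficiency inside the window `w₀ = 1.78·10⁻⁴`,
`Re·W = 326`; scoping scan S-RING-1 of the cell: maximal observed speed gain `1.169` against the required `2.056`).
Item 19249 stays OPEN; no verdict change; repair of record `HeredityAtOffStratum 1`.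

References: Th. Gallay, V. Šverák, Confluentes Math. 7 (2015) = arXiv:1510.01036, (1.3), Prop. 2.6 (2.14), Lemma 5.1,
Lemma 6.4 [cite: GallaySverak2016, Prop. 2.6 (2.14), Lemma 6.4]; J. Leray, Acta Math. 63 (1934) §32 [cite: Leray1934, §32];
S. Palasek, arXiv:2605.13827 §4 [cite: Palasek2026ElementaryModel, §4].
-/

noncomputable section

namespace Summit.NavierStokesRegularity.HeredityAtOneCombinedDoor

open Set MeasureTheory Filter Topology Function
open scoped ContDiff ENNReal Topology
open Literature.Analysis Literature.Analysis.FluidPDE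
open Summit.NavierStokesRegularity.FluidComputer
open Summit.NavierStokesRegularity.FluidComputer.PalasekTowerClayBridge
open Summit.NavierStokesRegularity.NavierStokesRegularity
open Summit.NavierStokesRegularity.HeredityAtOneNoSwirlCap
open Summit.NavierStokesRegularity.HeredityAtOneSpeedCap
open Summit.NavierStokesRegularity.HeredityAtOneNoSwirlStratum
open Summit.NavierStokesRegularity.HeredityAtOneSilentWindow
open Summit.NavierStokesRegularity.HeredityAtOneEnergyWindow
open Summit.NavierStokesRegularity.HeredityAtOneEnergyBound

variable {R : TowerRates} {S : Schedule R} {k : ℕ}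

/-- The fourth power of the cap radicand: `(√(√(L·I)·M'))⁴ = L·I·M'²` for `L·I ≥ 0`, `M' ≥ 0`. [folklore] -/
theorem sqrt_sqrt_mul_pow_four {L I M' : ℝ} (hLI : 0 ≤ L * I) (hM' : 0 ≤ M') :
    Real.sqrt (Real.sqrt (L * I) * M') ^ 4 = L * I * M' ^ 2 := by
  have h1 : Real.sqrt (Real.sqrt (L * I) * M') ^ 2 = Real.sqrt (L * I) * M' :=
    Real.sq_sqrt (mul_nonneg (Real.sqrt_nonneg _) hM')
  calc Real.sqrt (Real.sqrt (L * I) * M') ^ 4 = (Real.sqrt (Real.sqrt (L * I) * M') ^ 2) ^ 2 := by ring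
    _ = (Real.sqrt (L * I) * M') ^ 2 := by rw [h1]
    _ = Real.sqrt (L * I) ^ 2 * M' ^ 2 := by ring
    _ = L * I * M' ^ 2 := by rw [Real.sq_sqrt hLI]

/-- **The cap door to the fourth power**: a single-signed swirl-free slice `w` of height `M'` with
`0.35356 · √(√((∫η)(∫r²η)) · M') < B` has `0.35356⁴ · (∫η) · (∫r²η) · M'² < B⁴`. [cite: GallaySverak2016, Prop. 2.6 (2.14)] -/
theorem cap_pow_four_lt {w : EuclideanSpace ℝ (Fin 3) → EuclideanSpace ℝ (Fin 3)} {M' B : ℝ}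
    (hsl : SignedNoSwirlSlice w M')
    (hlt : 0.35356 * Real.sqrt (Real.sqrt ((∫ y, angVortQuot w y) * ∫ y, cylRadius y ^ 2 * angVortQuot w y) * M') < B) :
    0.35356 ^ 4 * ((∫ y, angVortQuot w y) * (∫ y, cylRadius y ^ 2 * angVortQuot w y) * M' ^ 2) < B ^ 4 := by
  have hL : 0 ≤ ∫ y, angVortQuot w y := integral_nonneg hsl.nonneg
  have hI : 0 ≤ ∫ y, cylRadius y ^ 2 * angVortQuot w y :=
    integral_nonneg fun y => mul_nonneg (sq_nonneg _) (hsl.nonneg y)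
  have hM' : 0 ≤ M' := (hsl.nonneg 0).trans (hsl.le 0)
  have h0 : 0 ≤ 0.35356 * Real.sqrt (Real.sqrt ((∫ y, angVortQuot w y) *
      ∫ y, cylRadius y ^ 2 * angVortQuot w y) * M') := mul_nonneg (by norm_num) (Real.sqrt_nonneg _)
  have h4 := pow_lt_pow_left₀ hlt h0 (by norm_num : (4 : ℕ) ≠ 0)
  rw [mul_pow, sqrt_sqrt_mul_pow_four (mul_nonneg hL hI) hM'] at h4
  exact h4

/-- **THE COMBINED DOOR (impulse-free), any rates.** On a SILENT design (`S.f = 0` on `[τ₀, ∞)`) with globally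
anchored margins whose host slice `s.u τ₀` is single-signed swirl-free, a registered level-`k` stage whose `τ_k`-slice is
single-signed swirl-free of height `M'` with Gallay–Šverák cap value below the next floor,
`0.35356 · √(√((∫η)(∫r²η)) · M') < c₁ Y_{k+1}` (`η = ω_θ/r` of `s.u τ_k`), satisfies
`4 · 0.35356⁴ · E(s.u τ_k) · (∫η) · M'² < c₁⁵ · Y₀ · Y_{k+1}⁴`: the energy door `4E ≤ c₁Y₀ ∫r²η`
(`kineticEnergy_le_quarter_of_silent_signed_host`) times the fourth power of the cap door; the impulse `∫r²η` cancels.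
[cite: GallaySverak2016, Prop. 2.6 (2.14), Lemma 6.4] [cite: Leray1934, §32] [cite: Palasek2026ElementaryModel, §4] -/
theorem combined_door_of_silent_signed_slice (hSil : ∀ t, S.τ 0 ≤ t → S.f t = 0)
    (s : Stage 1 R S (Margins.routeG R) k) {M : ℝ} (hsl : SignedNoSwirlSlice (s.u (S.τ 0)) M) {M' : ℝ}
    (hsl' : SignedNoSwirlSlice (s.u (S.τ k)) M')
    (hlt : 0.35356 * Real.sqrt (Real.sqrt ((∫ y, angVortQuot (s.u (S.τ k)) y) *
        ∫ y, cylRadius y ^ 2 * angVortQuot (s.u (S.τ k)) y) * M') < S.c₁ * R.Y (k + 1)) :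
    4 * 0.35356 ^ 4 * VectorCalculus.kineticEnergy (s.u (S.τ k)) * (∫ y, angVortQuot (s.u (S.τ k)) y) * M' ^ 2 <
      S.c₁ ^ 5 * R.Y 0 * R.Y (k + 1) ^ 4 := by
  set E := VectorCalculus.kineticEnergy (s.u (S.τ k)) with hEdef
  set L := ∫ y, angVortQuot (s.u (S.τ k)) y with hLdef
  set I := ∫ y, cylRadius y ^ 2 * angVortQuot (s.u (S.τ k)) y with hIdef
  have hE : E ≤ 1 / 4 * (S.c₁ * R.Y 0) * I :=
    kineticEnergy_le_quarter_of_silent_signed_host hSil s hsl (S.τ k) ⟨S.τ_mono (Nat.zero_le k), le_rfl⟩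
  have hL : 0 ≤ L := integral_nonneg hsl'.nonneg
  have hcap : 0.35356 ^ 4 * (L * I * M' ^ 2) < (S.c₁ * R.Y (k + 1)) ^ 4 := cap_pow_four_lt hsl' hlt
  have hY0 : 0 < R.Y 0 := Real.rpow_pos_of_pos (R.N_pos 0) _
  have hcY : 0 < S.c₁ * R.Y 0 := mul_pos S.c₁_pos hY0
  have h1 : 4 * 0.35356 ^ 4 * E * L * M' ^ 2 ≤ (S.c₁ * R.Y 0) * (0.35356 ^ 4 * (L * I * M' ^ 2)) := by
    have hLM : 0 ≤ L * M' ^ 2 := mul_nonneg hL (sq_nonneg _)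
    have h := mul_le_mul_of_nonneg_right
      (mul_le_mul_of_nonneg_left hE (by norm_num : (0 : ℝ) ≤ 4 * 0.35356 ^ 4)) hLM
    calc 4 * 0.35356 ^ 4 * E * L * M' ^ 2 = 4 * 0.35356 ^ 4 * E * (L * M' ^ 2) := by ring
      _ ≤ 4 * 0.35356 ^ 4 * (1 / 4 * (S.c₁ * R.Y 0) * I) * (L * M' ^ 2) := h
      _ = (S.c₁ * R.Y 0) * (0.35356 ^ 4 * (L * I * M' ^ 2)) := by ring
  calc 4 * 0.35356 ^ 4 * E * L * M' ^ 2 ≤ (S.c₁ * R.Y 0) * (0.35356 ^ 4 * (L * I * M' ^ 2)) := h1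
    _ < (S.c₁ * R.Y 0) * (S.c₁ * R.Y (k + 1)) ^ 4 := mul_lt_mul_of_pos_left hcap hcY
    _ = S.c₁ ^ 5 * R.Y 0 * R.Y (k + 1) ^ 4 := by ring

/-- **The combined door at a floor point (scale-free form), any rates.** In the setting of
`combined_door_of_silent_signed_slice`, at every point `x` where the level-`k` floor is met (`c₁ Y_k ≤ ‖s.u τ_k x‖`; such
a point exists in the tower's ball by `Stage.floor`):
`4 · 0.35356⁴ · Y_k⁵ · (E(s.u τ_k) · ∫η · M'²) < Y₀ · Y_{k+1}⁴ · ‖s.u τ_k x‖⁵` — the slice number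
`F = E · ∫η · M'² / sup‖u‖⁵` is below `Y₀Y_{k+1}⁴/(4 · 0.35356⁴ · Y_k⁵)` (wide rates: `185.6, 115.3, 68.3, 38.4, 20.4` at
`k = 1 … 5`; Hill's vortex has `F = 81.2`). [cite: GallaySverak2016, Prop. 2.6 (2.14), Lemma 6.4] [cite: Leray1934, §32]
[cite: Palasek2026ElementaryModel, §4] -/
theorem combined_door_floor_form (hSil : ∀ t, S.τ 0 ≤ t → S.f t = 0)
    (s : Stage 1 R S (Margins.routeG R) k) {M : ℝ} (hsl : SignedNoSwirlSlice (s.u (S.τ 0)) M) {M' : ℝ}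
    (hsl' : SignedNoSwirlSlice (s.u (S.τ k)) M')
    (hlt : 0.35356 * Real.sqrt (Real.sqrt ((∫ y, angVortQuot (s.u (S.τ k)) y) *
        ∫ y, cylRadius y ^ 2 * angVortQuot (s.u (S.τ k)) y) * M') < S.c₁ * R.Y (k + 1))
    {x : EuclideanSpace ℝ (Fin 3)} (hx : S.c₁ * R.Y k ≤ ‖s.u (S.τ k) x‖) :
    4 * 0.35356 ^ 4 * R.Y k ^ 5 *
        (VectorCalculus.kineticEnergy (s.u (S.τ k)) * (∫ y, angVortQuot (s.u (S.τ k)) y) * M' ^ 2) <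
      R.Y 0 * R.Y (k + 1) ^ 4 * ‖s.u (S.τ k) x‖ ^ 5 := by
  have h := combined_door_of_silent_signed_slice hSil s hsl hsl' hlt
  have hYk : 0 < R.Y k := Real.rpow_pos_of_pos (R.N_pos k) _
  have hY0 : 0 < R.Y 0 := Real.rpow_pos_of_pos (R.N_pos 0) _
  have hY1 : 0 < R.Y (k + 1) := Real.rpow_pos_of_pos (R.N_pos (k + 1)) _
  have hc0 : 0 ≤ S.c₁ * R.Y k := (mul_pos S.c₁_pos hYk).le
  have h5 : (S.c₁ * R.Y k) ^ 5 ≤ ‖s.u (S.τ k) x‖ ^ 5 := pow_le_pow_left₀ hc0 hx 5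
  have hYY : 0 ≤ R.Y 0 * R.Y (k + 1) ^ 4 := by positivity
  calc 4 * 0.35356 ^ 4 * R.Y k ^ 5 *
        (VectorCalculus.kineticEnergy (s.u (S.τ k)) * (∫ y, angVortQuot (s.u (S.τ k)) y) * M' ^ 2)
      = (4 * 0.35356 ^ 4 * VectorCalculus.kineticEnergy (s.u (S.τ k)) *
          (∫ y, angVortQuot (s.u (S.τ k)) y) * M' ^ 2) * R.Y k ^ 5 := by ring
    _ < (S.c₁ ^ 5 * R.Y 0 * R.Y (k + 1) ^ 4) * R.Y k ^ 5 := mul_lt_mul_of_pos_right h (pow_pos hYk 5)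
    _ = (R.Y 0 * R.Y (k + 1) ^ 4) * (S.c₁ * R.Y k) ^ 5 := by ring
    _ ≤ (R.Y 0 * R.Y (k + 1) ^ 4) * ‖s.u (S.τ k) x‖ ^ 5 := mul_le_mul_of_nonneg_left h5 hYY
    _ = R.Y 0 * R.Y (k + 1) ^ 4 * ‖s.u (S.τ k) x‖ ^ 5 := by ring

/-- **The combined door on the census stratum (wide rates; `c₁ = 1` by rigidity).** On a silent wide design with
globally anchored margins and single-signed swirl-free host, a registered level-`k` stage IN the capped stratum
`InCapStratum k S s` (p481383) has a slice height `M'` with `τ_k`-slice single-signed swirl-free of height `M'`,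
`4 · 0.35356⁴ · E(s.u τ_k) · ∫η · M'² < Y₀ · Y_{k+1}⁴`, and the scale-free form at every floor point.
[cite: GallaySverak2016, Prop. 2.6 (2.14), Lemma 6.4] [cite: Leray1934, §32] [cite: Palasek2026ElementaryModel, §4] -/
theorem combined_door_of_inCapStratum_silent {S : Schedule TowerRates.wide}
    (hSil : ∀ t, S.τ 0 ≤ t → S.f t = 0) (s : Stage 1 TowerRates.wide S (Margins.routeG TowerRates.wide) k)
    {M : ℝ} (hsl : SignedNoSwirlSlice (s.u (S.τ 0)) M) (h : InCapStratum k S s) :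
    ∃ M' : ℝ, SignedNoSwirlSlice (s.u (S.τ k)) M' ∧
      4 * 0.35356 ^ 4 * VectorCalculus.kineticEnergy (s.u (S.τ k)) * (∫ y, angVortQuot (s.u (S.τ k)) y) * M' ^ 2 <
        TowerRates.wide.Y 0 * TowerRates.wide.Y (k + 1) ^ 4 ∧
      ∀ x, TowerRates.wide.Y k ≤ ‖s.u (S.τ k) x‖ →
        4 * 0.35356 ^ 4 * TowerRates.wide.Y k ^ 5 *
            (VectorCalculus.kineticEnergy (s.u (S.τ k)) * (∫ y, angVortQuot (s.u (S.τ k)) y) * M' ^ 2) <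
          TowerRates.wide.Y 0 * TowerRates.wide.Y (k + 1) ^ 4 * ‖s.u (S.τ k) x‖ ^ 5 := by
  obtain ⟨M', hsl', hlt⟩ := h
  have hc : S.c₁ = 1 := s.routeG_rigid.c₁_eq
  refine ⟨M', hsl', ?_, fun x hx => ?_⟩
  · have h1 := combined_door_of_silent_signed_slice hSil s hsl hsl' hlt
    simpa only [hc, one_pow, one_mul] using h1
  · have hx' : S.c₁ * TowerRates.wide.Y k ≤ ‖s.u (S.τ k) x‖ := by rwa [hc, one_mul]
    exact combined_door_floor_form hSil s hsl hsl' hlt hx'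

/-- **The combined door under the host-form cap** (hypotheses of `inCapStratum_of_silent`, p505438): a registered
level-`k` stage of a silent wide design whose host slice is single-signed swirl-free of height `M` with HOST cap value
`0.35356 · √(√((∫η₀)(∫r²η₀)) · M) < c₁ Y_{k+1}` has `4 · 0.35356⁴ · E(s.u τ_k) · ∫η(s.u τ_k) · M² < Y₀ · Y_{k+1}⁴` and,
at every floor point `x` of the readout `τ_k`, `4 · 0.35356⁴ · Y_k⁵ · (E · ∫η · M²) < Y₀ · Y_{k+1}⁴ · ‖s.u τ_k x‖⁵`.
[cite: GallaySverak2016, Prop. 2.6 (2.14), Lemma 5.1, Lemma 6.4] [cite: Leray1934, §32] [cite: Palasek2026ElementaryModel, §4] -/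
theorem combined_door_of_silent_capped_host {S : Schedule TowerRates.wide}
    (hSil : ∀ t, S.τ 0 ≤ t → S.f t = 0) (s : Stage 1 TowerRates.wide S (Margins.routeG TowerRates.wide) k)
    {M : ℝ} (hsl : SignedNoSwirlSlice (s.u (S.τ 0)) M)
    (hlt : 0.35356 * Real.sqrt (Real.sqrt ((∫ y, angVortQuot (s.u (S.τ 0)) y) *
        ∫ y, cylRadius y ^ 2 * angVortQuot (s.u (S.τ 0)) y) * M) < S.c₁ * TowerRates.wide.Y (k + 1)) :
    4 * 0.35356 ^ 4 * VectorCalculus.kineticEnergy (s.u (S.τ k)) * (∫ y, angVortQuot (s.u (S.τ k)) y) * M ^ 2 <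
        TowerRates.wide.Y 0 * TowerRates.wide.Y (k + 1) ^ 4 ∧
      ∀ x, TowerRates.wide.Y k ≤ ‖s.u (S.τ k) x‖ →
        4 * 0.35356 ^ 4 * TowerRates.wide.Y k ^ 5 *
            (VectorCalculus.kineticEnergy (s.u (S.τ k)) * (∫ y, angVortQuot (s.u (S.τ k)) y) * M ^ 2) <
          TowerRates.wide.Y 0 * TowerRates.wide.Y (k + 1) ^ 4 * ‖s.u (S.τ k) x‖ ^ 5 := by
  have hτk : S.τ k ∈ Icc (S.τ 0) (S.τ k) := ⟨S.τ_mono (Nat.zero_le k), le_rfl⟩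
  have hsl' : SignedNoSwirlSlice (s.u (S.τ k)) M := signedNoSwirlSlice_of_silent hSil s hsl _ hτk
  have hlt' : 0.35356 * Real.sqrt (Real.sqrt ((∫ y, angVortQuot (s.u (S.τ k)) y) *
      ∫ y, cylRadius y ^ 2 * angVortQuot (s.u (S.τ k)) y) * M) < S.c₁ * TowerRates.wide.Y (k + 1) :=
    (cap_le_cap_τ_zero_of_silent (by norm_num) hSil s hsl _ hτk).trans_lt hlt
  have hc : S.c₁ = 1 := s.routeG_rigid.c₁_eq
  refine ⟨?_, fun x hx => ?_⟩
  · have h1 := combined_door_of_silent_signed_slice hSil s hsl hsl' hlt'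
    simpa only [hc, one_pow, one_mul] using h1
  · have hx' : S.c₁ * TowerRates.wide.Y k ≤ ‖s.u (S.τ k) x‖ := by rwa [hc, one_mul]
    exact combined_door_floor_form hSil s hsl hsl' hlt' hx'

/-- **Reading for item 19249 (level `k = 1`, by the route decl's name).** `PalasekTowerBreakdown.HeredityAtOne`
implies that NO silent pinned rigid wide design with single-signed swirl-free host registers a level-1 stage whose
`τ₁`-slice is single-signed swirl-free of some height `M'` with cap value `< Y₂` — in particular none whose slice number
passes the combined door; conversely such a stage (one satisfying, among the register's requirements, the necessary
condition `4 · 0.35356⁴ · E · ∫η · M'² < Y₀Y₂⁴`, `F < 185.6`) would refute the item (`heredityAtOne_false_of_inCapStratum`).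
Restated here only to pin the door to the item; no construction, no refutation. [cite: Palasek2026ElementaryModel, §4]
[cite: GallaySverak2016, Prop. 2.6 (2.14)] -/
theorem no_silent_signed_member_of_heredityAtOne (h : Theses.PalasekTowerBreakdown.HeredityAtOne)
    {S : Schedule TowerRates.wide} (hSil : ∀ t, S.τ 0 ≤ t → S.f t = 0) (hP : S.Pins 8 (6 / 5)) (hR : S.Rigid)
    (s : Stage 1 TowerRates.wide S (Margins.routeG TowerRates.wide) 1) : ¬ InCapStratum 1 S s :=
  capStratumEmptyAt_one_of_heredityAtOne h S hP hR (quiet_of_silent hSil) s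

end Summit.NavierStokesRegularity.HeredityAtOneCombinedDoor

end
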